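import Summits.AtomisticToContinuum.HydrodynamicLimit.Theorems.RelayRaceLocalityNearConstantShortTimeHLTiltL2Assembly
import Summits.AtomisticToContinuum.HydrodynamicLimit.Theorems.RelayRaceLocalityNearConstantShortTimeHLReductionPE
import Summits.AtomisticToContinuum.HydrodynamicLimit.Theorems.RelayRaceLocalityNearConstantShortTimeHLDynamicPE
import HarnessLib

/-!
# Crux `NearConstantShortTimeHL` (stmt-AtomisticToContinuum-12502), line `small-tilt-domination`, skeleton v23 (lead c9):
# the ENDGAME WITH SUPER-EXPONENTIAL VELOCITY TAILS — the crux from the closure K-stubs, the packing cap and all exponential velocity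
# moments in mean along the true law

Support file (`--supports stmt-AtomisticToContinuum-12502`). Composition of the landed pieces of skeleton v23: level 0 `stub_reductionPE`
(`…ReductionPE`, p157079) ∘ level 1 `stub_dynamicPE` (`…DynamicPE`, p155843) through the means-pin dock and the entropy-to-LLN step, with the
statics side of the line closed (`…TiltL2Assembly`). Compared with v20/v21 (`nearConstantShortTimeHL_of_dynamicsPQ : MomentumClosureTightnessPQ →
EnergyClosureTightnessPQ → TrueLawCapsPG → crux`, `…EndgamePQ`) the GAUSSIAN velocity-tail input along the true law (conjunct (c′) of
`TrueLawCapsPG`, the Nachtergaele–Yau Assumption II.1 transcribed) is WEAKENED to super-exponential tails in mean — all exponential velocity moments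
`E_{P_N}[n⁻¹Σᵢ exp(b‖vᵢ(s)‖)] ≤ A_b`, `b > 0`, uniformly on `[0,t]` (conjunct (c″) of `TrueLawCapsPE`, `…ExpTailDefs`): the cubic level of the
Grönwall assembly is chosen after the exponential rate `b = C_gi t/γ + 1` (`stub_dynamicPE`), and the integrated quartic cap along the true law
comes from `x⁴ ≤ (24/b⁴)e^{bx}` + Tonelli + Markov (`intFourthMoment_markovE`). This is the "minimal usable form" of the high-momentum input named by
the barrier audit `Literature.Barriers.AtomisticToContinuum.HighMomentumCutoffNarrow` (whose scope caveat (c) recorded the sufficiency of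
super-exponential tails only as "an inference from the `e^{δ⁻¹MT₀}` structure of [NachtergaeleYau2003, §7.2], not a printed theorem"); for this
architecture it is now kernel-checked. What stays open: S2⁗ `MomentumClosureTightnessPQ`, S3⁗ `EnergyClosureTightnessPQ` (equilibrium dynamical large
deviations under the invariant drifted Gibbs law, uniform rate) and S4‴ `TrueLawCapsPE` (ball-packing cap + super-exponential velocity tails in mean
along the true law).
References: H.-T. Yau, Lett. Math. Phys. 22 (1991) §2; B. Nachtergaele – H.-T. Yau, Comm. Math. Phys. 243 (2003) §3.2, §7.2.
-/

noncomputable section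

namespace Summit.AtomisticToContinuum.HydrodynamicLimit.Theorems.NearConstantShortTimeHL

open Summit.AtomisticToContinuum.HydrodynamicLimit.Theses.RelayRaceLocality (NearConstantShortTimeHL)

/-- **THE CRUX FROM ITS FOUR INPUTS WITH SUPER-EXPONENTIAL TAILS** (endgame of skeleton v23): the mesoscale static superlinearity St2′, the
equilibrium momentum / energy closure tightness under the packing and integrated quartic caps (S2⁗, S3⁗), and the packing cap plus all
exponential velocity moments in mean along the true law (S4‴). [cite: Yau1991, §2] -/
theorem nearConstantShortTimeHL_of_inputsPE : MesoscaleSuperlinearityE → MomentumClosureTightnessPQ → EnergyClosureTightnessPQ → TrueLawCapsPE → NearConstantShortTimeHL :=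
  fun hSt2 hS2 hS3 hS4 =>
    stub_entropyToLLN (stub_meansToRelEntropy (meansConverge_of_nearConstantRelEntropy
      (stub_meansPin stub_ldaGeneralFamilies stub_concentrationGeneralFamilies
        (stub_reductionPE stub_dynamicPE hSt2 stub_uniformPressure stub_staticLLN stub_smallTiltDomination hS2 hS3 hS4))))

/-- **THE CRUX FROM THE THREE DYNAMICAL CONJECTURES ALONE, SUPER-EXPONENTIAL TAILS.** With the statics side of the line closed, the
hydrodynamic-limit crux `NearConstantShortTimeHL` follows from the equilibrium momentum / energy closure tightness under the packing and integrated
quartic caps (S2⁗, S3⁗) and, along the true law, ONLY the ball-packing cap and super-exponential velocity tails in mean (S4‴) — no quartic, no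
speed-cap and no Gaussian-tail a-priori input. [cite: Yau1991, §2] [cite: NachtergaeleYau2003, §7.2] -/
theorem nearConstantShortTimeHL_of_dynamicsPE :
    MomentumClosureTightnessPQ → EnergyClosureTightnessPQ → TrueLawCapsPE → NearConstantShortTimeHL :=
  nearConstantShortTimeHL_of_inputsPE
    (mesoscaleSuperlinearityE_of (positionMesoscaleLD_of_densityLD mesoscaleDensityLD_holds) (stub_velocityLD stub_ballGaussianEstimate))

end Summit.AtomisticToContinuum.HydrodynamicLimit.Theorems.NearConstantShortTimeHL

end
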